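import Mathlib
import Literature.NumberTheory.LFunctions.Zhang2022.ToolkitSmoothEulerMajorant
import Literature.NumberTheory.LFunctions.Zhang2022.ToolkitDivisorMajorants
import HarnessLib

/-!
# Zhang (2022), §15 (15.17): the divisor-weight average `Σ_{d,l≤N} τ₂(dl)W(dl)/(dl) ≪ (log N)^k`
# behind the `o(p)` of (15.17) (`W(n) = ∏_{q∣n}(1 + c₀q^{−9/10})`, the weight of (15.15))

Topic `Literature/NumberTheory/LFunctions/Zhang2022` (Landau–Siegel audit tree; verdict-neutral).
Y. Zhang, *Discrete mean estimates and the Landau–Siegel zero*, arXiv:2211.02515v1 (2022)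
[Zhang2022LandauSiegel] — **an unrefereed manuscript under adjudication; nothing here asserts or denies
its Theorems 1–2.** In the (15.17) assembly ("Inserting this into (15.11) … + o(p)", §15 p. 85, tex
L4226) the termwise error of the ranged+weighted (15.15) — `≪ (e^{−c𝓛^{1/10}} + 𝓛^{−A})·W(d,l)` with the
Euler weight `W(n) = ∏_{q∣n}(1 + c₀q^{−9/10})` of §15.u035 — is summed against `|b(dl)|/(dl) ≪ τ₂(dl)/(dl)`
((15.2)) over the box `d, l ≤ P`. This file PROVES the polylogarithmic bound that makes the total `o(p)`:

* `weight_mul_le` — `W(mn) ≤ W(m)W(n)` (all factors are `≥ 1`);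
* `sum_tau_two_mul_weight_div_le` — `∃ C k, ∀ N ≥ 2, Σ_{n≤N} τ₂(n)W(n)/n ≤ C(log(N+1))^k`: the summand is
  the multiplicative majorant `∏_{q^r∥n}(r+1)(1 + c₀q^{−9/10})/n`, so the tree's Euler-product majorant
  over smooth numbers (`SmoothEulerMajorant.sum_smooth_multMajorant_div_le_prod`) and
  `Σ_{r≥1}(r+1)/q^r ≤ 6/q`, `∏_{q<y}(1 + k/q) ≤ e^{4k}(log y)^k` (`prod_primesBelow_one_add_le_log_pow`) apply;
* `sum_box_tau_two_mul_weight_div_le` — the box version `Σ_{d,l≤N} τ₂(dl)W(dl)/(dl) ≤ C(log(N+1))^k`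
  (`τ₂(dl) ≤ τ₂(d)τ₂(l)`, `W(dl) ≤ W(d)W(l)`).

Theorems only; no definitions, no facts; nothing about Landau–Siegel zeros.

## References

* Y. Zhang, arXiv:2211.02515v1 (2022), §15 (15.2) p. 79, (15.15)–(15.17) p. 85.
  [cite: Zhang2022LandauSiegel, §15 (15.17) p.85]
* R. R. Hall, G. Tenenbaum, *Divisors* (1988), §0.2 (multiplicative majorants over smooth numbers).
  [cite: HallTenenbaum1988, §0.2]
-/

noncomputable section

open Real Finset

namespace Literature.NumberTheory.LFunctions.Zhang2022.Typed.Section15B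

open Literature.NumberTheory.LFunctions.Zhang2022
open Literature.NumberTheory.LFunctions.Zhang2022.MeanSquareMajorant (tau tau_two_apply tau_mul_le tau_nonneg)
open Literature.NumberTheory.LFunctions.Zhang2022.SmoothEulerMajorant

/-! ## The weight `W(n) = ∏_{q∣n}(1 + c₀q^{−9/10})` -/

/-- Each factor `1 + c₀q^{−9/10}` is `≥ 1` (`c₀ ≥ 0`). [cite: Zhang2022LandauSiegel, §15 p.84] -/
theorem one_le_weight_factor {c₀ : ℝ} (hc₀ : 0 ≤ c₀) (q : ℕ) :
    1 ≤ 1 + c₀ * (q : ℝ) ^ (-(9 / 10 : ℝ)) := by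
  have : 0 ≤ c₀ * (q : ℝ) ^ (-(9 / 10 : ℝ)) := mul_nonneg hc₀ (Real.rpow_nonneg (Nat.cast_nonneg q) _)
  linarith

/-- `W(n) ≥ 1`. [cite: Zhang2022LandauSiegel, §15 p.84] -/
theorem one_le_weight {c₀ : ℝ} (hc₀ : 0 ≤ c₀) (S : Finset ℕ) :
    1 ≤ ∏ q ∈ S, (1 + c₀ * (q : ℝ) ^ (-(9 / 10 : ℝ))) := by
  refine le_of_eq_of_le (Finset.prod_const_one (s := S)).symm
    (Finset.prod_le_prod (fun _ _ => zero_le_one) fun q _ => one_le_weight_factor hc₀ q)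

/-- **`W(mn) ≤ W(m)W(n)`** (the prime factors of `mn` are among those of `m` and of `n`, and all factors
are `≥ 1`). [cite: Zhang2022LandauSiegel, §15 p.84] -/
theorem weight_mul_le {c₀ : ℝ} (hc₀ : 0 ≤ c₀) (m n : ℕ) :
    ∏ q ∈ (m * n).primeFactors, (1 + c₀ * (q : ℝ) ^ (-(9 / 10 : ℝ))) ≤
      (∏ q ∈ m.primeFactors, (1 + c₀ * (q : ℝ) ^ (-(9 / 10 : ℝ)))) *
        ∏ q ∈ n.primeFactors, (1 + c₀ * (q : ℝ) ^ (-(9 / 10 : ℝ))) := by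
  classical
  set f : ℕ → ℝ := fun q => 1 + c₀ * (q : ℝ) ^ (-(9 / 10 : ℝ)) with hf
  have hf1 : ∀ q, 1 ≤ f q := fun q => one_le_weight_factor hc₀ q
  have hf0 : ∀ q, 0 ≤ f q := fun q => zero_le_one.trans (hf1 q)
  have hsub : (m * n).primeFactors ⊆ m.primeFactors ∪ n.primeFactors := by
    rcases eq_or_ne m 0 with rfl | hm
    · simp
    rcases eq_or_ne n 0 with rfl | hn
    · simp
    rw [Nat.primeFactors_mul hm hn]
  calc ∏ q ∈ (m * n).primeFactors, f q ≤ ∏ q ∈ m.primeFactors ∪ n.primeFactors, f q := by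
        have hsd := Finset.prod_sdiff (f := f) hsub
        have h1 : 1 ≤ ∏ q ∈ (m.primeFactors ∪ n.primeFactors) \ (m * n).primeFactors, f q :=
          one_le_weight hc₀ _
        have h0 : 0 ≤ ∏ q ∈ (m * n).primeFactors, f q := Finset.prod_nonneg fun q _ => hf0 q
        calc ∏ q ∈ (m * n).primeFactors, f q = 1 * ∏ q ∈ (m * n).primeFactors, f q := (one_mul _).symm
          _ ≤ (∏ q ∈ (m.primeFactors ∪ n.primeFactors) \ (m * n).primeFactors, f q) *
                ∏ q ∈ (m * n).primeFactors, f q := mul_le_mul_of_nonneg_right h1 h0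
          _ = ∏ q ∈ m.primeFactors ∪ n.primeFactors, f q := hsd
    _ ≤ (∏ q ∈ m.primeFactors ∪ n.primeFactors, f q) *
          ∏ q ∈ m.primeFactors ∩ n.primeFactors, f q := by
        have h1 : 1 ≤ ∏ q ∈ m.primeFactors ∩ n.primeFactors, f q := one_le_weight hc₀ _
        have h0 : 0 ≤ ∏ q ∈ m.primeFactors ∪ n.primeFactors, f q :=
          Finset.prod_nonneg fun q _ => hf0 q
        have h2 := mul_le_mul_of_nonneg_left h1 h0
        rwa [mul_one] at h2
    _ = (∏ q ∈ m.primeFactors, f q) * ∏ q ∈ n.primeFactors, f q := Finset.prod_union_inter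

/-! ## The local series `Σ_{r≥1}(r+1)/q^r ≤ 6/q` -/

/-- `Σ_{r≥0} (r+2)(1/2)^r = 6`. [folklore] -/
private theorem hasSum_add_two_mul_half_pow :
    HasSum (fun r : ℕ => ((r : ℝ) + 2) * (1 / 2 : ℝ) ^ r) 6 := by
  have h1 : HasSum (fun r : ℕ => (r : ℝ) * (1 / 2 : ℝ) ^ r) 2 := by
    have h := hasSum_coe_mul_geometric_of_norm_lt_one (𝕜 := ℝ) (r := 1 / 2)
      (by rw [Real.norm_eq_abs]; norm_num)
    norm_num at h
    exact h
  have h2 : HasSum (fun r : ℕ => (1 / 2 : ℝ) ^ r) 2 := by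
    have h := hasSum_geometric_of_lt_one (r := 1 / 2) (by norm_num) (by norm_num)
    norm_num at h
    exact h
  have h := h1.add (h2.mul_left 2)
  have e : (2 : ℝ) + 2 * 2 = 6 := by norm_num
  rw [e] at h
  refine h.congr_fun fun r => ?_
  ring

/-- For a prime `q` and a weight `0 ≤ w`: the local series `Σ_{r≥0} (r+2)w/q^{r+1}` converges and is
`≤ 6w/q` (`q^{r+1} ≥ q·2^r`). [folklore] -/
private theorem local_series_le {q : ℕ} (hq : q.Prime) {w : ℝ} (hw : 0 ≤ w) :
    Summable (fun r : ℕ => ((r : ℝ) + 1 + 1) * w / (q : ℝ) ^ (r + 1)) ∧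
      ∑' r : ℕ, ((r : ℝ) + 1 + 1) * w / (q : ℝ) ^ (r + 1) ≤ 6 * w / q := by
  have hq2 : (2 : ℝ) ≤ q := by exact_mod_cast hq.two_le
  have hq0 : (0 : ℝ) < q := by linarith
  -- termwise: `(r+2)w/q^{r+1} ≤ (w/q)·(r+2)(1/2)^r`
  have hterm : ∀ r : ℕ, ((r : ℝ) + 1 + 1) * w / (q : ℝ) ^ (r + 1) ≤
      w / q * (((r : ℝ) + 2) * (1 / 2 : ℝ) ^ r) := by
    intro r
    have hpow : (2 : ℝ) ^ r ≤ (q : ℝ) ^ r := pow_le_pow_left₀ (by norm_num) hq2 r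
    have h2r : (0 : ℝ) < 2 ^ r := pow_pos (by norm_num) r
    have hqr : (0 : ℝ) < (q : ℝ) ^ r := pow_pos hq0 r
    rw [pow_succ, show ((r : ℝ) + 1 + 1) = (r : ℝ) + 2 by ring, one_div_pow,
      div_le_iff₀ (mul_pos hqr hq0)]
    calc ((r : ℝ) + 2) * w = w / q * (((r : ℝ) + 2) * (1 / 2 ^ r)) * (2 ^ r * q) := by
          field_simp
      _ ≤ w / q * (((r : ℝ) + 2) * (1 / 2 ^ r)) * ((q : ℝ) ^ r * q) := by
          gcongr
  have hnonneg : ∀ r : ℕ, 0 ≤ ((r : ℝ) + 1 + 1) * w / (q : ℝ) ^ (r + 1) := fun r => by positivity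
  have hmaj : HasSum (fun r : ℕ => w / q * (((r : ℝ) + 2) * (1 / 2 : ℝ) ^ r)) (w / q * 6) :=
    hasSum_add_two_mul_half_pow.mul_left _
  have hs : Summable (fun r : ℕ => ((r : ℝ) + 1 + 1) * w / (q : ℝ) ^ (r + 1)) :=
    Summable.of_nonneg_of_le hnonneg hterm hmaj.summable
  refine ⟨hs, ?_⟩
  calc ∑' r : ℕ, ((r : ℝ) + 1 + 1) * w / (q : ℝ) ^ (r + 1)
      ≤ ∑' r : ℕ, w / q * (((r : ℝ) + 2) * (1 / 2 : ℝ) ^ r) := hs.tsum_le_tsum hterm hmaj.summable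
    _ = w / q * 6 := hmaj.tsum_eq
    _ = 6 * w / q := by ring

/-! ## The averages -/

/-- **`Σ_{n≤N} τ₂(n)W(n)/n ≤ C(log(N+1))^k`** for `N ≥ 2`, with `C, k` depending only on `c₀ ≥ 0`
(`W(n) = ∏_{q∣n}(1 + c₀q^{−9/10})`): the summand is the multiplicative majorant with local weights
`a(q,r) = (r+1)(1 + c₀q^{−9/10})`; its sum over the `(N+1)`-smooth numbers `n ≤ N` is at most
`∏_{q≤N}(1 + Σ_{r≥1}a(q,r)q^{−r}) ≤ ∏_{q≤N}(1 + 6(1+c₀)/q) ≤ e^{4k}(log(N+1))^k`, `k = ⌈6(1+c₀)⌉`.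
[cite: Zhang2022LandauSiegel, §15 (15.17) p.85] -/
theorem sum_tau_two_mul_weight_div_le {c₀ : ℝ} (hc₀ : 0 ≤ c₀) :
    ∃ C : ℝ, 0 ≤ C ∧ ∃ k : ℕ, ∀ N : ℕ, 2 ≤ N →
      ∑ n ∈ Icc 1 N, tau 2 n * (∏ q ∈ n.primeFactors, (1 + c₀ * (q : ℝ) ^ (-(9 / 10 : ℝ)))) / n ≤
        C * Real.log ((N : ℝ) + 1) ^ k := by
  classical
  set k : ℕ := ⌈6 * (1 + c₀)⌉₊ with hk
  have hk6 : 6 * (1 + c₀) ≤ (k : ℝ) := Nat.le_ceil _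
  refine ⟨Real.exp (4 * k), (Real.exp_pos _).le, k, fun N hN => ?_⟩
  -- the local weights
  set a : ℕ → ℕ → ℝ := fun q r => ((r : ℝ) + 1) * (1 + c₀ * (q : ℝ) ^ (-(9 / 10 : ℝ))) with ha
  have hw0 : ∀ q : ℕ, 0 ≤ 1 + c₀ * (q : ℝ) ^ (-(9 / 10 : ℝ)) := fun q =>
    zero_le_one.trans (one_le_weight_factor hc₀ q)
  have hw1 : ∀ q : ℕ, 1 ≤ q → 1 + c₀ * (q : ℝ) ^ (-(9 / 10 : ℝ)) ≤ 1 + c₀ := by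
    intro q hq
    have : (q : ℝ) ^ (-(9 / 10 : ℝ)) ≤ 1 :=
      Real.rpow_le_one_of_one_le_of_nonpos (by exact_mod_cast hq) (by norm_num)
    nlinarith
  have ha0 : ∀ q r, 0 ≤ a q r := fun q r => by simp only [ha]; exact mul_nonneg (by positivity) (hw0 q)
  have hloc : ∀ q : ℕ, q.Prime →
      Summable (fun r : ℕ => a q (r + 1) / (q : ℝ) ^ (r + 1)) ∧
        ∑' r : ℕ, a q (r + 1) / (q : ℝ) ^ (r + 1) ≤ 6 * (1 + c₀) / q := by
    intro q hq
    obtain ⟨hs, hle⟩ := local_series_le hq (hw0 q)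
    have hfun : (fun r : ℕ => a q (r + 1) / (q : ℝ) ^ (r + 1)) =
        fun r : ℕ => ((r : ℝ) + 1 + 1) * (1 + c₀ * (q : ℝ) ^ (-(9 / 10 : ℝ))) / (q : ℝ) ^ (r + 1) := by
      funext r; simp only [ha]; push_cast; ring
    rw [hfun]
    refine ⟨hs, hle.trans ?_⟩
    have hq0 : (0 : ℝ) < q := by exact_mod_cast hq.pos
    exact div_le_div_of_nonneg_right (by nlinarith [hw1 q hq.one_lt.le]) hq0.le
  -- the summand is the majorant `M_a(n)/n`
  have hsummand : ∀ n ∈ Icc 1 N,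
      tau 2 n * (∏ q ∈ n.primeFactors, (1 + c₀ * (q : ℝ) ^ (-(9 / 10 : ℝ)))) / n =
        (∏ q ∈ n.primeFactors, a q (n.factorization q)) / n := by
    intro n hn
    have hn0 : n ≠ 0 := by have := (Finset.mem_Icc.mp hn).1; omega
    congr 1
    rw [tau_two_apply, Nat.card_divisors hn0, Nat.cast_prod, ← Finset.prod_mul_distrib]
    refine Finset.prod_congr rfl fun q _ => ?_
    simp only [ha]; push_cast; ring
  have hA : ∀ n ∈ Icc 1 N, n ∈ Nat.smoothNumbers (N + 1) := by
    intro n hn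
    obtain ⟨h1, h2⟩ := Finset.mem_Icc.mp hn
    rw [Nat.mem_smoothNumbers']
    intro p hp hpn
    have := Nat.le_of_dvd (by omega) hpn
    omega
  rw [Finset.sum_congr rfl hsummand]
  refine (sum_smooth_multMajorant_div_le_prod ha0 (fun q hq => (hloc q hq).1) hA).trans ?_
  -- the Euler product
  have hN3 : 3 ≤ N + 1 := by omega
  have h := prod_primesBelow_one_add_le_log_pow hN3 k (c := 0) le_rfl
    (e := fun q => ∑' r : ℕ, a q (r + 1) / (q : ℝ) ^ (r + 1))
    (fun q hq => tsum_nonneg fun r => div_nonneg (ha0 q _) (pow_nonneg (Nat.cast_nonneg q) _))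
    (fun q hq => by
      have hqp : q.Prime := (Nat.mem_primesBelow.mp hq).2
      have hq0 : (0 : ℝ) < q := by exact_mod_cast hqp.pos
      calc ∑' r : ℕ, a q (r + 1) / (q : ℝ) ^ (r + 1) ≤ 6 * (1 + c₀) / q := (hloc q hqp).2
        _ ≤ (k : ℝ) / q + 0 / (q : ℝ) ^ 2 := by
            rw [zero_div, add_zero]; exact div_le_div_of_nonneg_right hk6 hq0.le)
  simpa only [mul_zero, add_zero, Nat.cast_add, Nat.cast_one] using h

/-- **`Σ_{d,l≤N} τ₂(dl)W(dl)/(dl) ≤ C(log(N+1))^k`** for `N ≥ 2` (`C, k` depending on `c₀ ≥ 0`):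
`τ₂(dl) ≤ τ₂(d)τ₂(l)`, `W(dl) ≤ W(d)W(l)`, so the box sum is at most the square of
`Σ_{n≤N}τ₂(n)W(n)/n`. [cite: Zhang2022LandauSiegel, §15 (15.17) p.85] -/
theorem sum_box_tau_two_mul_weight_div_le {c₀ : ℝ} (hc₀ : 0 ≤ c₀) :
    ∃ C : ℝ, 0 ≤ C ∧ ∃ k : ℕ, ∀ N : ℕ, 2 ≤ N →
      ∑ d ∈ Icc 1 N, ∑ l ∈ Icc 1 N,
        tau 2 (d * l) * (∏ q ∈ (d * l).primeFactors, (1 + c₀ * (q : ℝ) ^ (-(9 / 10 : ℝ)))) /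
          ((d : ℝ) * l) ≤ C * Real.log ((N : ℝ) + 1) ^ k := by
  obtain ⟨C, hC, k, hS⟩ := sum_tau_two_mul_weight_div_le hc₀
  refine ⟨C * C, mul_nonneg hC hC, k + k, fun N hN => ?_⟩
  set W : ℕ → ℝ := fun n => ∏ q ∈ n.primeFactors, (1 + c₀ * (q : ℝ) ^ (-(9 / 10 : ℝ))) with hW
  have hW0 : ∀ n, 0 ≤ W n := fun n => zero_le_one.trans (one_le_weight hc₀ _)
  have hterm : ∀ d ∈ Icc 1 N, ∀ l ∈ Icc 1 N,
      tau 2 (d * l) * W (d * l) / ((d : ℝ) * l) ≤ (tau 2 d * W d / d) * (tau 2 l * W l / l) := by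
    intro d hd l hl
    have hd0 : (0 : ℝ) < d := by exact_mod_cast (Finset.mem_Icc.mp hd).1
    have hl0 : (0 : ℝ) < l := by exact_mod_cast (Finset.mem_Icc.mp hl).1
    rw [div_mul_div_comm]
    refine div_le_div_of_nonneg_right ?_ (mul_pos hd0 hl0).le
    calc tau 2 (d * l) * W (d * l) ≤ (tau 2 d * tau 2 l) * (W d * W l) :=
          mul_le_mul (tau_mul_le 2 d l) (weight_mul_le hc₀ d l) (hW0 _)
            (mul_nonneg (tau_nonneg _ _) (tau_nonneg _ _))
      _ = tau 2 d * W d * (tau 2 l * W l) := by ring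
  have hlog : 0 ≤ Real.log ((N : ℝ) + 1) := Real.log_nonneg (by
    have : (0 : ℝ) ≤ N := Nat.cast_nonneg N; linarith)
  calc ∑ d ∈ Icc 1 N, ∑ l ∈ Icc 1 N, tau 2 (d * l) * W (d * l) / ((d : ℝ) * l)
      ≤ ∑ d ∈ Icc 1 N, ∑ l ∈ Icc 1 N, (tau 2 d * W d / d) * (tau 2 l * W l / l) :=
        Finset.sum_le_sum fun d hd => Finset.sum_le_sum fun l hl => hterm d hd l hl
    _ = (∑ d ∈ Icc 1 N, tau 2 d * W d / d) * (∑ l ∈ Icc 1 N, tau 2 l * W l / l) := by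
        rw [Finset.sum_mul_sum]
    _ ≤ (C * Real.log ((N : ℝ) + 1) ^ k) * (C * Real.log ((N : ℝ) + 1) ^ k) :=
        mul_le_mul (hS N hN) (hS N hN) (Finset.sum_nonneg fun l _ => by
          have := hW0 l; have := tau_nonneg 2 l; positivity) (by positivity)
    _ = C * C * Real.log ((N : ℝ) + 1) ^ (k + k) := by rw [pow_add]; ring

end Literature.NumberTheory.LFunctions.Zhang2022.Typed.Section15B

end
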